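import Mathlib
import Literature.AlgebraicGeometry.Resolution.PCyclicCoverSections
import Summits.ResolutionOfSingularities.ResolutionOfSingularities.Theorems.PAlterationPicoverLocalModelLocalChartsKummerCentre
import Summits.ResolutionOfSingularities.ResolutionOfSingularities.Theorems.PAlterationPicoverLocalModelLocalChartsWoundCentre

/-!
# Crux `PicoverLocalModel` (stmt-ResolutionOfSingularities-0557), line `SketchIdeator3`
# (giraud-cossart-normal-form) — endgame: the local log-regular charts (`stub_localCharts`)

The stub `stub_localCharts` of the registered skeleton (v4): at every point `y` of the
normalisation `Y^ν` of the pulled-back `p`-cyclic cover `Y = Spec R[T]/(T^p - a) ×_{Spec R} W`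
of a regular `W` on which `π^* a` is in Giraud normal form along an snc boundary `E`, there is
a local log-regular chart whose stalk monoids are the divisorial monoids of the pulled-back
boundary (Kato 1994, Def. (2.1), Thm. 11.6).

Proof: the image `w ∈ W` of `y` is a wound/transversal or a Kummer centre of the normal form
(`InGiraudNormalForm`); the sections of `Y` over affine opens of `W` are generated by the
`p`-th root of `π^* a` (`exists_root_sections_pullback`); conclude by
`localChart_woundCentre` / `localChart_kummerCentre`, which spread the normal form to an
affine chart, build the orthant / Kummer chart on the sections of `Y^ν` and verify Kato's
condition prime by prime through the local models `B ⊗_A 𝒪_{W,w'}` (wound twist, resp.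
Kummer toric algebra, both identified with the integral closure of `𝒪_{W,w'}[T]/(T^p - a)`).
-/

noncomputable section

-- single-problem summit: the doubled namespace component `ResolutionOfSingularities` is the tree layout
set_option linter.dupNamespace false

open CategoryTheory CategoryTheory.Limits AlgebraicGeometry TopologicalSpace Polynomial
open Literature.AlgebraicGeometry.Resolution

namespace Summit.ResolutionOfSingularities.ResolutionOfSingularities.Theorems.PicoverLocalModel.LocalCharts

/-- **Local log-regular charts on the normalised `p`-cyclic cover** (stub `stub_localCharts`
of the line `SketchIdeator3`). [cite: Kato1994, Def. (2.1) and Thm. 11.6] -/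
theorem stub_localCharts : ∀ (p : ℕ) [Fact p.Prime] (k : Type) [Field k] [CharP k p] (W : Scheme.{0}) (f : W ⟶ Spec (.of k)) [IsSeparated f] [LocallyOfFiniteType f] [QuasiCompact f] [IsIntegral W], Scheme.IsRegular W → ∀ (R : Type) [CommRing R] (π : W ⟶ Spec (.of R)) (a : R) (E : List W.IdealSheafData), HasSNC E → InGiraudNormalForm p W π a E → ∀ [IsIntegral (pullback (Spec.map (CommRingCat.ofHom (algebraMap R (AdjoinRoot ((X : R[X]) ^ p - C a))))) π)], ∀ y : ↥(normalization (pullback (Spec.map (CommRingCat.ofHom (algebraMap R (AdjoinRoot ((X : R[X]) ^ p - C a))))) π)), Nonempty (LocalLogRegularChart (normalization (pullback (Spec.map (CommRingCat.ofHom (algebraMap R (AdjoinRoot ((X : R[X]) ^ p - C a))))) π)) (fun y => divisorialMonoid (((E.map fun D => stalkIdeal D ((normalizationι (pullback (Spec.map (CommRingCat.ofHom (algebraMap R (AdjoinRoot ((X : R[X]) ^ p - C a))))) π) ≫ pullback.snd (Spec.map (CommRingCat.ofHom (algebraMap R (AdjoinRoot ((X : R[X]) ^ p - C a))))) π).base y))).prod.map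 ((normalizationι (pullback (Spec.map (CommRingCat.ofHom (algebraMap R (AdjoinRoot ((X : R[X]) ^ p - C a))))) π) ≫ pullback.snd (Spec.map (CommRingCat.ofHom (algebraMap R (AdjoinRoot ((X : R[X]) ^ p - C a))))) π).stalkMap y).hom)) y) := by
  intro p _ k _ _ W f _ _ _ _ hreg R _ π a E hE hG _ y
  haveI := isFinite_SpecMap_adjoinRoot p a
  haveI := surjective_SpecMap_adjoinRoot p a
  have hsec := exists_root_sections_pullback p a π
  -- the centre and its normal form
  obtain ⟨r, D, x, hDbij, hDgen, hNF⟩ := hG ((normalizationι _ ≫ pullback.snd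
    (Spec.map (CommRingCat.ofHom (algebraMap R (AdjoinRoot ((X : R[X]) ^ p - C a))))) π).base y)
  rcases hNF with ⟨g₀, u₀, Bexp, hwt, ha⟩ | ⟨g₀, Aexp, v₀, ⟨j₀, hj₀⟩, ha⟩
  · exact localChart_woundCentre p k W f hreg R π a E hE hG _ (pullback.snd _ π) hsec y _ rfl D x
      hDbij hDgen g₀ u₀ Bexp hwt ha
  · exact localChart_kummerCentre p k W f hreg R π a E hE hG _ (pullback.snd _ π) hsec y _ rfl D x
      hDbij hDgen g₀ Aexp v₀ j₀ hj₀ ha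

end Summit.ResolutionOfSingularities.ResolutionOfSingularities.Theorems.PicoverLocalModel.LocalCharts

end
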